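import Summits.RiemannHypothesis.RiemannHypothesis.Theorems.SignConeFakeWeightReduction
import Literature.NumberTheory.LFunctions.WeilCriterionConverse
import Literature.NumberTheory.LFunctions.WeilMarkovQuadratic

/-!
# `ConeMagnification`: the fake Weil form is bounded on translates (route `SignCone`, item
stmt-RiemannHypothesis-16303; HELPER file, `--supports`)

First step of the continuation theorem for weights in the unit-slack cone (W-MAG §2 "structure
theorem"; here by the translation/polarisation device of `WeilCriterionConverse.norm_expSum_le`). Put
`Φ_c(K) := W_ar(K) - P_c(K) + K(0)` (`W_ar = weilPolarTerm + weilArchTerm`,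
`P_c(K) = Σₙ c(n) n^{-1/2}(K(log n) + K(-log n))`), a linear functional on Weil test kernels with the
reflection symmetry `Φ_c(K̃) = conj Φ_c(K)`. The unit-slack hypothesis `-‖g‖₂² ≤ Re (W_ar - P_c)(g ⋆ g̃)` for
every Weil test `g` says `0 ≤ Re Φ_c(g ⋆ g̃)`; applied to `g + γ g_x` (`g_x(t) = g(t - x)`, `|γ| = 1`), whose
autocorrelation is `2 G + conj γ · G(· + x) + γ · G(· - x)` (`G = g ⋆ g̃`), it yields

  `‖Φ_c(G(· - x))‖ ≤ Re Φ_c(G)`  for every real `x`  (`norm_fakeForm_weilTranslate_le`):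

the fake Weil form of a unit-slack weight is BOUNDED along the translates of every autocorrelation
kernel. (Its Laplace transform in `x` then continues `D_c(s) M_G(s) - M_G(1)/(s-1)` to `Re s > 1/2`, the
input of the Landau transfer `SignConeConeMagnificationLandau.lean` — next file.)

Contents: translation rules for the kernel `(φ, ψ) ↦ φ ⋆ ψ̃` (`weilConv_weilReflect_weilTranslate_left/right`,
`weilConv_weilReflect_translateMix`), linearity and reflection symmetry of `Φ_c` (`fakeForm_add`,
`fakeForm_const_mul`, `fakeForm_weilReflect`), and the bound.
-/

noncomputable section

-- `Summit.RiemannHypothesis.RiemannHypothesis.…` repeats a namespace component by design (D-0017 layout).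
set_option linter.dupNamespace false

open scoped BigOperators ComplexConjugate ArithmeticFunction.vonMangoldt Real
open Complex MeasureTheory Set Filter

namespace Summit.RiemannHypothesis.RiemannHypothesis.Theorems.SignCone

open Literature.NumberTheory.LFunctions
open Literature.NumberTheory.LFunctions.WeilConverse
open Summit.RiemannHypothesis.RiemannHypothesis.Theorems.RuelleBandCofiniteCriticalLine

variable {g : ℝ → ℂ}

/-! ## Translation rules for the kernel `φ ⋆ ψ̃` -/

/-- `(φ ⋆ ψ̃)(t) = ∫ φ(u) conj ψ(u - t) du`. [folklore] -/
theorem weilConv_weilReflect_eq_integral_conj (φ ψ : ℝ → ℂ) (t : ℝ) :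
    weilConv φ (weilReflect ψ) t = ∫ u : ℝ, φ u * conj (ψ (u - t)) := by
  rw [weilConv_apply]
  congr 1 with u
  simp [weilReflect, neg_sub]

/-- Translating the left factor translates the kernel: `(φ_x ⋆ ψ̃)(t) = (φ ⋆ ψ̃)(t - x)`. [folklore] -/
theorem weilConv_weilReflect_weilTranslate_left (φ ψ : ℝ → ℂ) (x t : ℝ) :
    weilConv (weilTranslate φ x) (weilReflect ψ) t = weilConv φ (weilReflect ψ) (t - x) := by
  rw [weilConv_weilReflect_eq_integral_conj, weilConv_weilReflect_eq_integral_conj]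
  have key := integral_sub_right_eq_self (μ := (volume : Measure ℝ))
    (fun v : ℝ ↦ φ v * conj (ψ (v - (t - x)))) x
  rw [← key]
  congr 1 with u
  simp only [weilTranslate]
  congr 3
  ring

/-- Translating the right factor: `(φ ⋆ (ψ_x)̃)(t) = (φ ⋆ ψ̃)(t + x)`. [folklore] -/
theorem weilConv_weilReflect_weilTranslate_right (φ ψ : ℝ → ℂ) (x t : ℝ) :
    weilConv φ (weilReflect (weilTranslate ψ x)) t = weilConv φ (weilReflect ψ) (t + x) := by
  rw [weilConv_weilReflect_eq_integral_conj, weilConv_weilReflect_eq_integral_conj]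
  congr 1 with u
  simp only [weilTranslate]
  congr 3
  ring

/-- The autocorrelation kernel is translation invariant: `g_x ⋆ (g_x)̃ = g ⋆ g̃`. [folklore] -/
theorem weilConv_weilReflect_weilTranslate (φ : ℝ → ℂ) (x : ℝ) :
    weilConv (weilTranslate φ x) (weilReflect (weilTranslate φ x)) = weilConv φ (weilReflect φ) := by
  funext t
  rw [weilConv_weilReflect_weilTranslate_left, weilConv_weilReflect_weilTranslate_right, sub_add_cancel]

/-- **The autocorrelation of `g + γ g_x`** is `(1 + |γ|²) G + conj γ · G(· + x) + γ · G(· - x)`,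
`G = g ⋆ g̃` (sesquilinearity, `stub_branchesContinuous_weilConv_weilReflect_comb`, and the translation
rules). [folklore] -/
theorem weilConv_weilReflect_translateMix (hg : IsWeilTest g) (γ : ℂ) (x t : ℝ) :
    weilConv (translateMix g γ x) (weilReflect (translateMix g γ x)) t =
      (1 + Complex.normSq γ) * weilConv g (weilReflect g) t +
        conj γ * weilConv g (weilReflect g) (t + x) + γ * weilConv g (weilReflect g) (t - x) := by
  have hfam : ∀ i ∈ (Finset.univ : Finset (Fin 2)), IsWeilTest (![g, weilTranslate g x] i) := by
    intro i _
    fin_cases i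
    · exact hg
    · exact hg.weilTranslate x
  have hmix : translateMix g γ x = fun t => ∑ i : Fin 2, (![1, γ] i) * (![g, weilTranslate g x] i) t := by
    funext u
    simp [translateMix, Fin.sum_univ_two]
  rw [hmix, stub_branchesContinuous_weilConv_weilReflect_comb Finset.univ _ hfam]
  simp only [Fin.sum_univ_two, Matrix.cons_val_zero, Matrix.cons_val_one, map_one, one_mul]
  rw [weilConv_weilReflect_weilTranslate_left, weilConv_weilReflect_weilTranslate_right,
    weilConv_weilReflect_weilTranslate_left, weilConv_weilReflect_weilTranslate_right, sub_add_cancel,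
    ← Complex.mul_conj]
  ring

/-- For a hermitian kernel (`conj G(-t) = G(t)`), the reflection of a translate is the opposite
translate: `(G(· - x))̃ = G(· + x)`. [folklore] -/
theorem weilReflect_weilTranslate_of_selfAdjoint {G : ℝ → ℂ} (hG : ∀ t, conj (G (-t)) = G t) (x : ℝ) :
    weilReflect (weilTranslate G x) = weilTranslate G (-x) := by
  funext t
  simp only [weilReflect, weilTranslate, sub_neg_eq_add]
  rw [show -t - x = -(t + x) by ring, hG]

/-! ## The functional `Φ_c(K) = W_ar(K) - P_c(K) + K(0)`: linearity and reflection symmetry -/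

/-- Additivity of `Φ_c` on Weil test kernels. [folklore] -/
theorem fakeForm_add (c : ℕ → ℝ) {K₁ K₂ : ℝ → ℂ} (h₁ : IsWeilTest K₁) (h₂ : IsWeilTest K₂) :
    (weilPolarTerm (K₁ + K₂) + weilArchTerm (K₁ + K₂) -
        (∑' n : ℕ, ((c n : ℝ) : ℂ) / (Real.sqrt n : ℂ) * ((K₁ + K₂) (Real.log n) + (K₁ + K₂) (-Real.log n))) +
        (K₁ + K₂) 0) =
      (weilPolarTerm K₁ + weilArchTerm K₁ -
        (∑' n : ℕ, ((c n : ℝ) : ℂ) / (Real.sqrt n : ℂ) * (K₁ (Real.log n) + K₁ (-Real.log n))) + K₁ 0) +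
      (weilPolarTerm K₂ + weilArchTerm K₂ -
        (∑' n : ℕ, ((c n : ℝ) : ℂ) / (Real.sqrt n : ℂ) * (K₂ (Real.log n) + K₂ (-Real.log n))) + K₂ 0) := by
  have hW : weilPolarTerm (K₁ + K₂) + weilArchTerm (K₁ + K₂) =
      (weilPolarTerm K₁ + weilArchTerm K₁) + (weilPolarTerm K₂ + weilArchTerm K₂) := by
    have h := weilArchPolar_finset_sum (Finset.univ : Finset (Fin 2)) (G := ![K₁, K₂])
      (fun i _ => by fin_cases i <;> assumption)
    simp only [Fin.sum_univ_two, Matrix.cons_val_zero, Matrix.cons_val_one] at h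
    have e : (fun t => K₁ t + K₂ t) = K₁ + K₂ := rfl
    rw [e] at h
    exact h
  have hP : (∑' n : ℕ, ((c n : ℝ) : ℂ) / (Real.sqrt n : ℂ) * ((K₁ + K₂) (Real.log n) + (K₁ + K₂) (-Real.log n))) =
      (∑' n : ℕ, ((c n : ℝ) : ℂ) / (Real.sqrt n : ℂ) * (K₁ (Real.log n) + K₁ (-Real.log n))) +
      ∑' n : ℕ, ((c n : ℝ) : ℂ) / (Real.sqrt n : ℂ) * (K₂ (Real.log n) + K₂ (-Real.log n)) := by
    rw [← (summable_fakePrimeTerm c h₁.2).tsum_add (summable_fakePrimeTerm c h₂.2)]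
    refine tsum_congr fun n => ?_
    simp only [Pi.add_apply]
    ring
  rw [hW, hP]
  simp only [Pi.add_apply]
  ring

/-- Homogeneity of `Φ_c` (no hypotheses). [folklore] -/
theorem fakeForm_const_mul (c : ℕ → ℝ) (m : ℂ) (K : ℝ → ℂ) :
    (weilPolarTerm (fun t => m * K t) + weilArchTerm (fun t => m * K t) -
        (∑' n : ℕ, ((c n : ℝ) : ℂ) / (Real.sqrt n : ℂ) * (m * K (Real.log n) + m * K (-Real.log n))) +
        m * K 0) =
      m * (weilPolarTerm K + weilArchTerm K -
        (∑' n : ℕ, ((c n : ℝ) : ℂ) / (Real.sqrt n : ℂ) * (K (Real.log n) + K (-Real.log n))) + K 0) := by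
  have hdec : ∀ F : ℝ → ℂ, weilPolarTerm F + weilArchTerm F = weilFunctional F + weilPrimeTerm F := by
    intro F; unfold weilFunctional; ring
  have hPr : weilPrimeTerm (fun t => m * K t) = m * weilPrimeTerm K := by
    simp only [weilPrimeTerm]
    rw [← tsum_mul_left]
    congr 1 with n
    ring
  have hP : (∑' n : ℕ, ((c n : ℝ) : ℂ) / (Real.sqrt n : ℂ) * (m * K (Real.log n) + m * K (-Real.log n))) =
      m * ∑' n : ℕ, ((c n : ℝ) : ℂ) / (Real.sqrt n : ℂ) * (K (Real.log n) + K (-Real.log n)) := by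
    rw [← tsum_mul_left]
    congr 1 with n
    ring
  rw [hdec, hdec K, weilFunctional_const_mul, hPr, hP]
  ring

/-- **Reflection symmetry** `Φ_c(K̃) = conj Φ_c(K)` (no hypotheses): `(K̃)^(s) = conj K̂(1 - conj s)`
swaps `K̂(0), K̂(1)` and conjugates `K̂(1/2 + it)`; `K̃(±log n) = conj K(∓log n)`, `K̃(0) = conj K(0)`.
[folklore] -/
theorem fakeForm_weilReflect (c : ℕ → ℝ) (K : ℝ → ℂ) :
    (weilPolarTerm (weilReflect K) + weilArchTerm (weilReflect K) -
        (∑' n : ℕ, ((c n : ℝ) : ℂ) / (Real.sqrt n : ℂ) *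
          (weilReflect K (Real.log n) + weilReflect K (-Real.log n))) + weilReflect K 0) =
      conj (weilPolarTerm K + weilArchTerm K -
        (∑' n : ℕ, ((c n : ℝ) : ℂ) / (Real.sqrt n : ℂ) * (K (Real.log n) + K (-Real.log n))) + K 0) := by
  have hM : ∀ s : ℂ, weilMellin (weilReflect K) s = conj (weilMellin K (1 - conj s)) :=
    fun s => weilMellin_weilReflect_holds K s
  have hPol : weilPolarTerm (weilReflect K) = conj (weilPolarTerm K) := by
    unfold weilPolarTerm
    rw [hM, hM, map_add]
    simp only [map_zero, sub_zero, map_one, sub_self]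
    ring
  have hAI : weilArchIntegral (weilReflect K) = conj (weilArchIntegral K) := by
    unfold weilArchIntegral
    rw [← integral_conj]
    congr 1 with t
    have e : (1 : ℂ) - conj (1 / 2 + (t : ℂ) * I) = 1 / 2 + (t : ℂ) * I := by
      apply Complex.ext
      · simp; norm_num
      · simp
    rw [hM, e, map_mul, Complex.conj_ofReal]
  have hA : weilArchTerm (weilReflect K) = conj (weilArchTerm K) := by
    unfold weilArchTerm
    rw [hAI, map_sub, map_mul, map_mul]
    simp only [weilReflect, neg_zero, Complex.conj_ofReal, map_div₀, map_one, map_mul, map_ofNat]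
  have hP : (∑' n : ℕ, ((c n : ℝ) : ℂ) / (Real.sqrt n : ℂ) *
      (weilReflect K (Real.log n) + weilReflect K (-Real.log n))) =
      conj (∑' n : ℕ, ((c n : ℝ) : ℂ) / (Real.sqrt n : ℂ) * (K (Real.log n) + K (-Real.log n))) := by
    rw [Complex.conj_tsum]
    refine tsum_congr fun n => ?_
    simp only [weilReflect, neg_neg, map_mul, map_add, map_div₀, Complex.conj_ofReal]
    ring
  rw [hPol, hA, hP]
  simp only [weilReflect, neg_zero, map_add, map_sub]

/-! ## The bound on translates -/

/-- **The fake Weil form of a unit-slack weight is bounded on translates.** If `c` satisfies the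
unit-slack inequality `-‖φ‖₂² ≤ Re (W_ar - P_c)(φ ⋆ φ̃)` for EVERY Weil test `φ`, then for every Weil test
`g` and every real `x`, with `G = g ⋆ g̃` and `Φ_c(K) = W_ar(K) - P_c(K) + K(0)`,
`‖Φ_c(G(· - x))‖ ≤ Re Φ_c(G)` (expand `0 ≤ Re Φ_c` at the autocorrelation of `g + γ g_x` with
`γ = -conj E/|E|`, `E = Φ_c(G(· - x))`; the cross terms are `conj γ · conj E + γ · E` by the reflection
symmetry). [folklore] -/
theorem norm_fakeForm_weilTranslate_le {c : ℕ → ℝ}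
    (hU : ∀ φ : ℝ → ℂ, IsWeilTest φ →
      -(∫ t, ‖φ t‖ ^ 2) ≤
        (weilPolarTerm (weilConv φ (weilReflect φ)) + weilArchTerm (weilConv φ (weilReflect φ)) -
          ∑' n : ℕ, ((c n : ℝ) : ℂ) / (Real.sqrt n : ℂ) *
            (weilConv φ (weilReflect φ) (Real.log n) + weilConv φ (weilReflect φ) (-Real.log n))).re)
    (hg : IsWeilTest g) (x : ℝ) :
    ‖weilPolarTerm (weilTranslate (weilConv g (weilReflect g)) x) +
        weilArchTerm (weilTranslate (weilConv g (weilReflect g)) x) -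
        (∑' n : ℕ, ((c n : ℝ) : ℂ) / (Real.sqrt n : ℂ) *
          (weilTranslate (weilConv g (weilReflect g)) x (Real.log n) +
            weilTranslate (weilConv g (weilReflect g)) x (-Real.log n))) +
        weilTranslate (weilConv g (weilReflect g)) x 0‖ ≤
      (weilPolarTerm (weilConv g (weilReflect g)) + weilArchTerm (weilConv g (weilReflect g)) -
        (∑' n : ℕ, ((c n : ℝ) : ℂ) / (Real.sqrt n : ℂ) *
          (weilConv g (weilReflect g) (Real.log n) + weilConv g (weilReflect g) (-Real.log n))) +
        weilConv g (weilReflect g) 0).re := by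
  -- the functional, the kernel and its translates
  set Φ : (ℝ → ℂ) → ℂ := fun K => weilPolarTerm K + weilArchTerm K -
    (∑' n : ℕ, ((c n : ℝ) : ℂ) / (Real.sqrt n : ℂ) * (K (Real.log n) + K (-Real.log n))) + K 0 with hΦ
  set G : ℝ → ℂ := weilConv g (weilReflect g) with hG
  set Tp : ℝ → ℂ := weilTranslate G x with hTp
  set Tm : ℝ → ℂ := weilTranslate G (-x) with hTm
  have hGt : IsWeilTest G := hg.weilConv hg.weilReflect
  have hTpt : IsWeilTest Tp := hGt.weilTranslate x
  have hTmt : IsWeilTest Tm := hGt.weilTranslate (-x)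
  have hsym : ∀ t, conj (G (-t)) = G t := fun t => conj_weilConv_weilReflect_neg g t
  -- positivity of `Re Φ` on autocorrelations
  have hpos : ∀ φ : ℝ → ℂ, IsWeilTest φ → 0 ≤ (Φ (weilConv φ (weilReflect φ))).re := by
    intro φ hφ
    have h := hU φ hφ
    have h0 : (weilConv φ (weilReflect φ) 0).re = ∫ t, ‖φ t‖ ^ 2 := by
      rw [weilConv_weilReflect_apply_zero, Complex.ofReal_re]
    simp only [hΦ, Complex.add_re, Complex.sub_re] at h ⊢
    rw [h0]
    linarith
  -- `Φ(Tm) = conj Φ(Tp)` (reflection symmetry, `Tm = T̃p`)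
  have hrefl : Φ Tm = conj (Φ Tp) := by
    have e : Tm = weilReflect Tp := by
      rw [hTm, hTp, weilReflect_weilTranslate_of_selfAdjoint hsym x]
    rw [e]
    exact fakeForm_weilReflect c Tp
  -- the expansion `Φ(G_{g + γ g_x}) = (1 + |γ|²) Φ(G) + conj γ Φ(Tm) + γ Φ(Tp)`
  have hexp : ∀ γ : ℂ, Φ (weilConv (translateMix g γ x) (weilReflect (translateMix g γ x))) =
      (1 + Complex.normSq γ) * Φ G + conj γ * Φ Tm + γ * Φ Tp := by
    intro γ
    have e : weilConv (translateMix g γ x) (weilReflect (translateMix g γ x)) =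
        (fun t => ((1 + Complex.normSq γ : ℝ) : ℂ) * G t) + ((fun t => conj γ * Tm t) + fun t => γ * Tp t) := by
      funext t
      simp only [Pi.add_apply, hTm, hTp, weilTranslate, sub_neg_eq_add, hG]
      rw [weilConv_weilReflect_translateMix hg]
      push_cast
      ring
    have h1 : IsWeilTest (fun t => ((1 + Complex.normSq γ : ℝ) : ℂ) * G t) := hGt.const_mul _
    have h2 : IsWeilTest (fun t => conj γ * Tm t) := hTmt.const_mul _
    have h3 : IsWeilTest (fun t => γ * Tp t) := hTpt.const_mul _
    rw [e]
    have hA := fakeForm_add c h1 (h2.add h3)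
    have hB := fakeForm_add c h2 h3
    have hC1 := fakeForm_const_mul c ((1 + Complex.normSq γ : ℝ) : ℂ) G
    have hC2 := fakeForm_const_mul c (conj γ) Tm
    have hC3 := fakeForm_const_mul c γ Tp
    simp only [hΦ]
    simp only [Pi.add_apply] at hA hB ⊢
    rw [hA, hB, hC1, hC2, hC3]
    push_cast
    ring
  -- the `γ`-trick
  set E : ℂ := Φ Tp with hE
  by_cases hE0 : E = 0
  · have : Φ Tp = 0 := hE0
    rw [show (weilPolarTerm Tp + weilArchTerm Tp -
      (∑' n : ℕ, ((c n : ℝ) : ℂ) / (Real.sqrt n : ℂ) * (Tp (Real.log n) + Tp (-Real.log n))) + Tp 0) = Φ Tp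
      from rfl, this, norm_zero]
    exact hpos g hg
  have hn0 : ‖E‖ ≠ 0 := norm_ne_zero_iff.2 hE0
  have hn : (‖E‖ : ℂ) ≠ 0 := by exact_mod_cast hn0
  set γ : ℂ := -conj E / (‖E‖ : ℂ) with hγ
  have hγE : γ * E = -(‖E‖ : ℂ) := by
    rw [hγ, div_mul_eq_mul_div, neg_mul, Complex.conj_mul', neg_div]
    congr 1
    rw [sq, mul_div_assoc, div_self hn, mul_one]
  have hγ1 : Complex.normSq γ = 1 := by
    rw [Complex.normSq_eq_norm_sq, hγ, norm_div, norm_neg, Complex.norm_conj, Complex.norm_real,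
      Real.norm_eq_abs, abs_norm, div_self hn0, one_pow]
  have h0 := hpos _ (isWeilTest_translateMix hg γ x)
  rw [hexp γ, hrefl, ← map_mul, hγE, hγ1] at h0
  have key : (((1 : ℂ) + ((1 : ℝ) : ℂ)) * Φ G + conj (-((‖E‖ : ℝ) : ℂ)) + -((‖E‖ : ℝ) : ℂ)).re =
      2 * (Φ G).re - 2 * ‖E‖ := by
    simp [Complex.mul_re]
    ring
  rw [key] at h0
  show ‖E‖ ≤ (Φ G).re
  linarith

end Summit.RiemannHypothesis.RiemannHypothesis.Theorems.SignCone

end
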